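import Summits.QuantumFields.BalabanUV.Beta.RemainderExplicitHistoryDiagonalWindow

/-!
# RemainderExplicitHistoryDiagonalBoundedMemoryRate — ROAD P3, ORDER-0 PROFILE FAMILY: BEYOND A BOUNDED MEMORY THE CUTOFF DISCREPANCY CONTRACTS
# BY THE FIRST MOMENT — for two infrared-pinned runs (A: `K` steps, B: `K + n` steps) of `β_{k+1} = b + Σ_{i≤k} ρ(k−i)·min(g_k, |g_k − g_i|)` with a
# profile of ANY SHAPE supported on the ages `≤ A`, at every position `A ≤ j ≤ K` the matched discrepancy IS a window sum of coupling gaps,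
# `d_j = Σ_{a≤A} ρ(a)·(Σ_{i∈[j−a,j)} e_i − Σ_{i∈[K−a,K)} e_i)`, hence `d_j ≤ M₁·((g^A_{j−1})³∕2)·max_{[j−A,j)} d` with the FIRST MOMENT
# `M₁ = Σ_a a·ρ(a)`: every memory length towards the pin costs the factor `M₁g³∕2`, and for a pinned family the continuum coupling at infrared
# distance `m` is reached in the cutoff at the rate `astar g m − invSq g m n ≤ θ_m^{⌊n∕A⌋}·(n+m)Wγ`, `θ_m = M₁γ∕(2(1∕g_IR² + b(m+1))) ≤ 1`
# (station S-d4p3-g53-1 «exact monotonity in the position», third file: the bounded-memory rate; independent of the first two files)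

Cell `pub-balaban`, β-function sub-cell, BINDER row D4 «RemainderConst leaves for Bałaban's split» (`HOME/BINDER-OWNERS.md`; owner lineage
`b2b-balaban-beta-an4`; this file by co-owner #3 lineage `b2b-balaban-beta-d4-p3`, road P3 «the reduction road», generation 53, station
S-d4p3-g53-1, third file; imports generation 49's `RemainderExplicitHistoryDiagonalWindow` only), β-FLOW TEAM duty (1); FREEZE (0) honoured
(def-free module in road P3's own `RemainderExplicit*` series; no leaf, no interface, no Literature file).  SOURCE OF THE SHAPES ONLY:
[Balaban1987RG1] (0.20) p. 256, (0.31) and Thm 2 p. 259, §5 p. 298.  [folklore] real analysis about ONE explicit toy family (ours).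
HONEST FRAMING: *"Discharging BetaPertH makes Bałaban's UV stability UNCONDITIONAL — a real constructive-QFT result; it is NOT the continuum
limit and NOT the Clay problem."*  THIS FILE DISCHARGES NOTHING OF THE KIND; nothing of Bałaban's (1.22) is asserted or constructed; row D4
class UNCHANGED (critical-path width 0; instance 0∕1; D4 DISCHARGE NO DATE); NOT B12 Thm 2, NOT BetaPertH, NOT continuum, NOT Clay.  HONEST
DEPENDENCY: continuum YM on T⁴ ⇐ BetaPertH ∧ nine spine estimates (0/9 proved); BetaPertH ⇐ (D1) ∧ (D4) ∧ CAP+tail; G-an2-4 gates asym, D1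
and NE2/3/4.  ABSOLUTE RULE: nothing is cited as a fact.  All letters NOT-IN-PRINT; `BetaFlowAsPrinted S` records a Markov β_n only.

WHY.  Generations 48–52 priced the cutoff discrepancy by the profile's MISSING AGES; beyond a bounded memory that local source VANISHES and
g52's renewal principles (`disc_le_supersolution` ∕ `disc_ge_subsolution`) only locate `d` between two implicit recursions.  Here the step
identity `d_l − d_{l+1} = E_l + Σ_{i≤l} ρ(l−i)(e_i − e_l)` (g49's `disc_step_window`) is summed from the pin in CLOSED FORM for a profile supported
on the ages `≤ A`: for `l ≥ A` there is no extra age (`E_l = 0`) and `Σ_{a≤A} ρ(a)(e_{l−a} − e_l)` is the increment of the window functional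
`Φ(l) = Σ_{a≤A} ρ(a)·Σ_{i∈[l−a,l)} e_i = Σ_{s=1}^{A} ρ̄(s)·e_{l−s}` (`ρ̄` the tail sums), so `d_j = Φ(j) − Φ(K)` on `[A, K]` (§1) — the matched
discrepancy at a position IS the tail-weighted sum of the last `A` coupling gaps, minus the same sum at the pin.  With the conversion
`e ≤ (g³∕2)·d` (g47's `gap_le_cube_mul`) and `Σ_s ρ̄(s) = Σ_a a·ρ(a) = M₁`: `d_j ≤ M₁·((g^A_{j−1})³∕2)·max_{[j−A,j)} d`, a contraction per memory
length whenever `M₁g³ < 2`, i.e. block by block `d_j ≤ θ^{⌊j∕A⌋}·max_{[0,A)} d` (§1 `disc_le_pow_blocks`).  For a pinned family read at infrared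
distance `m` (§2) the couplings concerned sit at infrared distances `≥ m + 1` (`g³ ≤ γ∕(1∕g_IR² + b(m+1))`, g47's `prof_le_invSq_orderZero`) and
`max d ≤ (n+m)Wγ` (g47's `|invSq − astar| ≤ m·W·γ`), whence the title's rate: GEOMETRIC in `n∕A` with a ratio that is itself `O(1∕m)` — the
shape of the profile inside its support never enters, only `M₁`.  (One-step memory, where the closed form has a single term and the lower side
is equally explicit, is the station's second file `…OneStepRate`; g48–g52's polynomial profiles have `A = ∞` and are not touched.)

WHAT IS PROVED ([folklore]; 0 sorry; 0 `def`; profile `ρ ≥ 0` with `ρ(a) = 0` for `a > A`, `b > 0`; `e_i = g^A_i − g^B_{i+n}`, `d_j = 1∕(g^B_{j+n})² − 1∕(g^A_j)²`).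
* §1 TWO PINNED RUNS (A: `K` steps, B: `K + n` steps, positive couplings, pinned): `disc_step_boundedMemory` (`A ≤ l < K` ⇒ `d_l − d_{l+1} =
  Σ_{a≤A} ρ(a)(e_{l−a} − e_l)`), **`disc_eq_windowSum_sub`** (`A ≤ j ≤ K` ⇒ `d_j = Σ_{a≤A} ρ(a)(Σ_{i∈[j−a,j)} e_i − Σ_{i∈[K−a,K)} e_i)`),
  `disc_le_windowSum`, **`disc_le_firstMoment_mul`** (`d_i ≤ P` on `[j−A, j)` and `(g^A_{j−1})³ ≤ G₃` ⇒ `d_j ≤ M₁(G₃∕2)·P`),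
  **`disc_le_pow_blocks`** (`θ = M₁G₃∕2 ≤ 1`, `(g^A_i)³ ≤ G₃` below `j₁ ≤ K`, `d ≤ P` on `[0,A)` ⇒ `d_j ≤ θ^{⌊j∕A⌋}·P` for all `j ≤ j₁`).
* §2 PINNED FAMILY (`g K` the run with `K` steps in ]0,γ], `g K K = g_IR`; `γ > 0`, `Σ_{a<N} ρ(a) ≤ W`): **`astar_sub_invSq_boundedMemory_rate`**
  (`θ_m = M₁γ∕(2(1∕g_IR² + b(m+1))) ≤ 1` ⇒ `astar g m − invSq g m n ≤ θ_m^{⌊n∕A⌋}·(n+m)·W·γ` for all `n`),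
  `astar_sub_invSq_boundedMemory_rate_far` (`Wγ ≤ b`, `A ≤ 2(m+1)` ⇒ `θ_m ≤ 1` automatically: the same bound with no further hypothesis).
-/

noncomputable section

open Finset Filter Topology

namespace Summit.QuantumFields.BalabanUV.Beta.RemainderExplicitHistoryDiagonalBoundedMemoryRate

open Literature.MathematicalPhysics.QuantumFieldTheory.Balaban1983to89
open Literature.MathematicalPhysics.QuantumFieldTheory.Balaban1983to89.FlowStep
open Literature.MathematicalPhysics.QuantumFieldTheory.Balaban1983to89.T4CouplingMatching
open Literature.MathematicalPhysics.QuantumFieldTheory.Balaban1983to89.T4ContinuumCoupling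
open Summit.QuantumFields.BalabanUV.Beta.RemainderExplicitHistoryDiagonalMonotone
open Summit.QuantumFields.BalabanUV.Beta.RemainderExplicitHistoryDiagonalWeights
open Summit.QuantumFields.BalabanUV.Beta.RemainderExplicitHistoryDiagonalTwoRun
open Summit.QuantumFields.BalabanUV.Beta.RemainderExplicitHistoryDiagonalWindow

variable {β : HBeta} {b γ W : ℝ} {ρ : ℕ → ℝ}

/-! ## §1 Two pinned runs with a bounded memory: the window closed form and the first-moment contraction -/

/-- **THE STEP BEYOND THE MEMORY.**  Profile supported on the ages `≤ A` (`ρ(a) = 0` for `a > A`; `b > 0`, `ρ ≥ 0`); two runs (A: `K` steps,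
B: `K + n` steps, positive couplings); `A ≤ l < K`.  THEN `d_l − d_{l+1} = Σ_{a≤A} ρ(a)·(e_{l−a} − e_l)` — B has no extra age of positive weight,
and the common ages are re-indexed by the age. [cite: Balaban1987RG1, (0.20) p.256] -/
theorem disc_step_boundedMemory
    (hβ : ∀ (k : ℕ) (p : Fin (k + 1) → ℝ),
      β k p = b + ∑ i : Fin (k + 1), ρ (k - i) * min (p (Fin.last k)) (|p (Fin.last k) - p i|))
    (hb : 0 < b) (hρ0 : ∀ a, 0 ≤ ρ a) {A : ℕ} (hρA : ∀ a, A < a → ρ a = 0) {K n : ℕ} {gA gB : ℕ → ℝ} (hA : RGEqH K β gA)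
    (hB : RGEqH (K + n) β gB) (hApos : ∀ k, k ≤ K → 0 < gA k) (hBpos : ∀ k, k ≤ K + n → 0 < gB k) {l : ℕ} (hAl : A ≤ l)
    (hl : l < K) :
    (1 / (gB (l + n)) ^ 2 - 1 / (gA l) ^ 2) - (1 / (gB (l + 1 + n)) ^ 2 - 1 / (gA (l + 1)) ^ 2)
      = ∑ a ∈ range (A + 1), ρ a * ((gA (l - a) - gB (l - a + n)) - (gA l - gB (l + n))) := by
  rw [disc_step_window hβ hb hρ0 hA hB hApos hBpos hl]
  have hE : ∑ i ∈ range n, ρ (l + n - i) * (gB (l + n) - gB i) = 0 := by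
    refine Finset.sum_eq_zero fun i hi => ?_
    have hi' : i < n := Finset.mem_range.mp hi
    rw [hρA (l + n - i) (by omega), zero_mul]
  -- re-index the common ages by the age `a = l − i`
  have hF : ∑ i ∈ range (l + 1), ρ (l - i) * ((gA i - gB (i + n)) - (gA l - gB (l + n)))
      = ∑ a ∈ range (l + 1), ρ a * ((gA (l - a) - gB (l - a + n)) - (gA l - gB (l + n))) := by
    rw [← Finset.sum_range_reflect (fun a => ρ a * ((gA (l - a) - gB (l - a + n)) - (gA l - gB (l + n)))) (l + 1)]
    refine Finset.sum_congr rfl fun i hi => ?_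
    have hi' := Finset.mem_range.mp hi
    simp only [show l + 1 - 1 - i = l - i by omega, show l - (l - i) = i by omega]
  -- the ages `a > A` carry no weight
  have hT : ∑ a ∈ range (l + 1), ρ a * ((gA (l - a) - gB (l - a + n)) - (gA l - gB (l + n)))
      = ∑ a ∈ range (A + 1), ρ a * ((gA (l - a) - gB (l - a + n)) - (gA l - gB (l + n))) := by
    refine (Finset.sum_subset (Finset.range_mono (by omega : A + 1 ≤ l + 1)) fun a ha hna => ?_).symm
    have : A < a := by
      have h1 := Finset.mem_range.mp ha
      have h2 : ¬ a < A + 1 := fun h => hna (Finset.mem_range.mpr h)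
      omega
    rw [hρA a this, zero_mul]
  rw [hE, hF, hT, zero_add]

/-- THE WINDOW MOVES BY ONE: for `a ≤ l`, `Σ_{i∈[l−a,l)} e_i − Σ_{i∈[l+1−a,l+1)} e_i = e_{l−a} − e_l`. [folklore] -/
theorem windowSum_sub_windowSum_succ (e : ℕ → ℝ) {a l : ℕ} (hal : a ≤ l) :
    (∑ i ∈ Ico (l - a) l, e i) - ∑ i ∈ Ico (l + 1 - a) (l + 1), e i = e (l - a) - e l := by
  rcases Nat.eq_zero_or_pos a with ha | ha
  · subst ha; simp
  · rw [Finset.sum_Ico_succ_top (by omega : l + 1 - a ≤ l), Finset.sum_eq_sum_Ico_succ_bot (by omega : l - a < l),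
      show l - a + 1 = l + 1 - a by omega]
    ring

/-- **THE WINDOW CLOSED FORM.**  Same runs, pinned `g^A_K = g^B_{K+n}`; `A ≤ j ≤ K`.  THEN
`1∕(g^B_{j+n})² − 1∕(g^A_j)² = Σ_{a≤A} ρ(a)·(Σ_{i∈[j−a,j)} (g^A_i − g^B_{i+n}) − Σ_{i∈[K−a,K)} (g^A_i − g^B_{i+n}))` — the step beyond the memory
is the increment of the window functional `Φ(l) = Σ_a ρ(a)Σ_{i∈[l−a,l)} e_i`, summed from the pin `d_K = 0`. [cite: Balaban1987RG1, (0.20) p.256 and Thm 2 p.259] -/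
theorem disc_eq_windowSum_sub
    (hβ : ∀ (k : ℕ) (p : Fin (k + 1) → ℝ),
      β k p = b + ∑ i : Fin (k + 1), ρ (k - i) * min (p (Fin.last k)) (|p (Fin.last k) - p i|))
    (hb : 0 < b) (hρ0 : ∀ a, 0 ≤ ρ a) {A : ℕ} (hρA : ∀ a, A < a → ρ a = 0) {K n : ℕ} {gA gB : ℕ → ℝ} (hA : RGEqH K β gA)
    (hB : RGEqH (K + n) β gB) (hApos : ∀ k, k ≤ K → 0 < gA k) (hBpos : ∀ k, k ≤ K + n → 0 < gB k) (hpin : gA K = gB (K + n))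
    {j : ℕ} (hAj : A ≤ j) (hjK : j ≤ K) :
    1 / (gB (j + n)) ^ 2 - 1 / (gA j) ^ 2
      = ∑ a ∈ range (A + 1), ρ a * ((∑ i ∈ Ico (j - a) j, (gA i - gB (i + n))) - ∑ i ∈ Ico (K - a) K, (gA i - gB (i + n))) := by
  set d : ℕ → ℝ := fun j => 1 / (gB (j + n)) ^ 2 - 1 / (gA j) ^ 2 with hd
  set e : ℕ → ℝ := fun i => gA i - gB (i + n) with he
  set Φ : ℕ → ℝ := fun l => ∑ a ∈ range (A + 1), ρ a * ∑ i ∈ Ico (l - a) l, e i with hΦ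
  have hdK : d K = 0 := by simp [hd, hpin]
  -- the increments of `d` and of `Φ` agree beyond the memory
  have hstep : ∀ l, A ≤ l → l < K → d l - d (l + 1) = Φ l - Φ (l + 1) := by
    intro l hAl hl
    have h := disc_step_boundedMemory hβ hb hρ0 hρA hA hB hApos hBpos hAl hl
    have h' : d l - d (l + 1) = ∑ a ∈ range (A + 1), ρ a * (e (l - a) - e l) := by
      simpa [hd, he, Nat.add_right_comm l 1 n] using h
    rw [h', hΦ]
    simp only
    rw [← Finset.sum_sub_distrib]
    refine Finset.sum_congr rfl fun a ha => ?_
    have ha' : a ≤ l := by have := Finset.mem_range.mp ha; omega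
    rw [← mul_sub, windowSum_sub_windowSum_succ e ha']
  -- sum from the pin
  suffices hmain : ∀ t, A + t ≤ K → d (K - t) = Φ (K - t) - Φ K by
    have h := hmain (K - j) (by omega)
    rw [show K - (K - j) = j by omega] at h
    rw [show (1 / (gB (j + n)) ^ 2 - 1 / (gA j) ^ 2) = d j from rfl, h, hΦ]
    simp only
    rw [← Finset.sum_sub_distrib]
    refine Finset.sum_congr rfl fun a _ => by rw [← mul_sub]
  intro t
  induction t with
  | zero => intro _; rw [Nat.sub_zero, hdK, sub_self]
  | succ t ih =>
    intro ht
    have h1 := ih (by omega)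
    have h2 := hstep (K - (t + 1)) (by omega) (by omega)
    rw [show K - (t + 1) + 1 = K - t by omega, h1] at h2
    linarith

/-- THE PIN WINDOW ONLY LOWERS IT: `A ≤ j ≤ K` ⇒ `1∕(g^B_{j+n})² − 1∕(g^A_j)² ≤ Σ_{a≤A} ρ(a)·Σ_{i∈[j−a,j)} (g^A_i − g^B_{i+n})` (every gap is `≥ 0`
by the maximum principle). [cite: Balaban1987RG1, (0.20) p.256 and Thm 2 p.259] -/
theorem disc_le_windowSum
    (hβ : ∀ (k : ℕ) (p : Fin (k + 1) → ℝ),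
      β k p = b + ∑ i : Fin (k + 1), ρ (k - i) * min (p (Fin.last k)) (|p (Fin.last k) - p i|))
    (hb : 0 < b) (hρ0 : ∀ a, 0 ≤ ρ a) {A : ℕ} (hρA : ∀ a, A < a → ρ a = 0) {K n : ℕ} {gA gB : ℕ → ℝ} (hA : RGEqH K β gA)
    (hB : RGEqH (K + n) β gB) (hApos : ∀ k, k ≤ K → 0 < gA k) (hBpos : ∀ k, k ≤ K + n → 0 < gB k) (hpin : gA K = gB (K + n))
    {j : ℕ} (hAj : A ≤ j) (hjK : j ≤ K) :
    1 / (gB (j + n)) ^ 2 - 1 / (gA j) ^ 2 ≤ ∑ a ∈ range (A + 1), ρ a * ∑ i ∈ Ico (j - a) j, (gA i - gB (i + n)) := by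
  rw [disc_eq_windowSum_sub hβ hb hρ0 hρA hA hB hApos hBpos hpin hAj hjK]
  have hdom := invSq_le_invSq_shift_run hβ hb hρ0 hA hB hApos hBpos hpin
  refine Finset.sum_le_sum fun a _ => ?_
  rw [mul_sub]
  have hK : 0 ≤ ρ a * ∑ i ∈ Ico (K - a) K, (gA i - gB (i + n)) := by
    refine mul_nonneg (hρ0 a) (Finset.sum_nonneg fun i hi => ?_)
    have hi' : i < K := (Finset.mem_Ico.mp hi).2
    linarith [le_of_one_div_sq_le (hApos i hi'.le) (hBpos (i + n) (by omega)) (hdom i hi'.le)]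
  linarith

/-- **THE FIRST-MOMENT CONTRACTION.**  Same runs; `A ≤ j ≤ K`; a bound `P` of `d` on the window `[j−A, j)` and a bound `G₃` of `(g^A_{j−1})³`.  THEN
`1∕(g^B_{j+n})² − 1∕(g^A_j)² ≤ (Σ_{a≤A} a·ρ(a))·(G₃∕2)·P` — on the window every gap is `e_i ≤ ((g^A_i)³∕2)·d_i ≤ (G₃∕2)·P` (g47's `gap_le_cube_mul`,
the run increases) and the age `a` meets `a` of them. [cite: Balaban1987RG1, (0.20) p.256 and Thm 2 p.259] -/
theorem disc_le_firstMoment_mul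
    (hβ : ∀ (k : ℕ) (p : Fin (k + 1) → ℝ),
      β k p = b + ∑ i : Fin (k + 1), ρ (k - i) * min (p (Fin.last k)) (|p (Fin.last k) - p i|))
    (hb : 0 < b) (hρ0 : ∀ a, 0 ≤ ρ a) {A : ℕ} (hρA : ∀ a, A < a → ρ a = 0) {K n : ℕ} {gA gB : ℕ → ℝ} (hA : RGEqH K β gA)
    (hB : RGEqH (K + n) β gB) (hApos : ∀ k, k ≤ K → 0 < gA k) (hBpos : ∀ k, k ≤ K + n → 0 < gB k) (hpin : gA K = gB (K + n))
    {j : ℕ} (hAj : A ≤ j) (hjK : j ≤ K) {P G₃ : ℝ} (hG : (gA (j - 1)) ^ 3 ≤ G₃)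
    (hP : ∀ i, i < j → j ≤ i + A → 1 / (gB (i + n)) ^ 2 - 1 / (gA i) ^ 2 ≤ P) :
    1 / (gB (j + n)) ^ 2 - 1 / (gA j) ^ 2 ≤ (∑ a ∈ range (A + 1), ρ a * a) * (G₃ / 2) * P := by
  have hdom := invSq_le_invSq_shift_run hβ hb hρ0 hA hB hApos hBpos hpin
  refine (disc_le_windowSum hβ hb hρ0 hρA hA hB hApos hBpos hpin hAj hjK).trans ?_
  rw [Finset.sum_mul, Finset.sum_mul]
  refine Finset.sum_le_sum fun a ha => ?_
  have haA : a ≤ A := by have := Finset.mem_range.mp ha; omega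
  -- each gap on the window is at most `(G₃∕2)·P`
  have hterm : ∀ i ∈ Ico (j - a) j, gA i - gB (i + n) ≤ G₃ / 2 * P := by
    intro i hi
    have hi1 := (Finset.mem_Ico.mp hi).1
    have hi2 := (Finset.mem_Ico.mp hi).2
    have hiK : i ≤ K := by omega
    have hdi : 0 ≤ 1 / (gB (i + n)) ^ 2 - 1 / (gA i) ^ 2 := by linarith [hdom i hiK]
    have hBA : gB (i + n) ≤ gA i := le_of_one_div_sq_le (hApos i hiK) (hBpos (i + n) (by omega)) (hdom i hiK)
    have h1 := gap_le_cube_mul (hBpos (i + n) (by omega)) hBA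
    have hmono : gA i ≤ gA (j - 1) := run_mono_orderZero hβ hb hρ0 hA hApos (by omega) (by omega)
    have hcube : (gA i) ^ 3 ≤ G₃ := (pow_le_pow_left₀ (hApos i hiK).le hmono 3).trans hG
    have hPi := hP i hi2 (by omega)
    calc gA i - gB (i + n) ≤ (gA i) ^ 3 / 2 * (1 / (gB (i + n)) ^ 2 - 1 / (gA i) ^ 2) := h1
      _ ≤ G₃ / 2 * (1 / (gB (i + n)) ^ 2 - 1 / (gA i) ^ 2) := by nlinarith
      _ ≤ G₃ / 2 * P := by
          have hG0 : 0 ≤ G₃ := le_trans (pow_nonneg (hApos (j - 1) (by omega)).le 3) hG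
          nlinarith
  have hsum : ∑ i ∈ Ico (j - a) j, (gA i - gB (i + n)) ≤ (a : ℝ) * (G₃ / 2 * P) := by
    have h := Finset.sum_le_sum hterm
    rw [Finset.sum_const, Nat.card_Ico, show j - (j - a) = a by omega, nsmul_eq_mul] at h
    exact h
  have := mul_le_mul_of_nonneg_left hsum (hρ0 a)
  linarith

/-- **BLOCK BY BLOCK.**  Same runs; `1 ≤ A`; a position `j₁ ≤ K` below which every coupling cube is `≤ G₃`; `θ = (Σ_a a·ρ(a))·G₃∕2 ≤ 1`; and a bound
`0 ≤ P` of `d` on the first window `[0, A)`.  THEN for every `j ≤ j₁`: `1∕(g^B_{j+n})² − 1∕(g^A_j)² ≤ θ^{⌊j∕A⌋}·P` — strong induction on the position: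
on the window `[j−A, j)` the block index is at least `⌊j∕A⌋ − 1`, so `disc_le_firstMoment_mul` gains one factor `θ`. [cite: Balaban1987RG1, (0.20) p.256 and Thm 2 p.259] -/
theorem disc_le_pow_blocks
    (hβ : ∀ (k : ℕ) (p : Fin (k + 1) → ℝ),
      β k p = b + ∑ i : Fin (k + 1), ρ (k - i) * min (p (Fin.last k)) (|p (Fin.last k) - p i|))
    (hb : 0 < b) (hρ0 : ∀ a, 0 ≤ ρ a) {A : ℕ} (hA1 : 1 ≤ A) (hρA : ∀ a, A < a → ρ a = 0) {K n : ℕ} {gA gB : ℕ → ℝ}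
    (hA : RGEqH K β gA) (hB : RGEqH (K + n) β gB) (hApos : ∀ k, k ≤ K → 0 < gA k) (hBpos : ∀ k, k ≤ K + n → 0 < gB k)
    (hpin : gA K = gB (K + n)) {j₁ : ℕ} (hj₁ : j₁ ≤ K) {P G₃ : ℝ} (hG : ∀ i, i < j₁ → (gA i) ^ 3 ≤ G₃)
    (hθ1 : (∑ a ∈ range (A + 1), ρ a * a) * (G₃ / 2) ≤ 1) (hP0 : 0 ≤ P)
    (hP : ∀ i, i < A → i ≤ K → 1 / (gB (i + n)) ^ 2 - 1 / (gA i) ^ 2 ≤ P) :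
    ∀ j, j ≤ j₁ → 1 / (gB (j + n)) ^ 2 - 1 / (gA j) ^ 2 ≤ ((∑ a ∈ range (A + 1), ρ a * a) * (G₃ / 2)) ^ (j / A) * P := by
  set θ : ℝ := (∑ a ∈ range (A + 1), ρ a * a) * (G₃ / 2) with hθ
  have hM0 : 0 ≤ ∑ a ∈ range (A + 1), ρ a * a := Finset.sum_nonneg fun a _ => mul_nonneg (hρ0 a) (Nat.cast_nonneg a)
  intro j
  induction j using Nat.strong_induction_on with
  | _ j ih =>
    intro hj
    by_cases hjA : j < A
    · rw [Nat.div_eq_of_lt hjA, pow_zero, one_mul]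
      exact hP j hjA (by omega)
    · rw [not_lt] at hjA
      -- here `G₃ ≥ (g^A_{j−1})³ ≥ 0`, so `θ ≥ 0`
      have hGj : (gA (j - 1)) ^ 3 ≤ G₃ := hG (j - 1) (by omega)
      have hG0 : 0 ≤ G₃ := le_trans (pow_nonneg (hApos (j - 1) (by omega)).le 3) hGj
      have hθ0 : 0 ≤ θ := by rw [hθ]; positivity
      have hq : (j - A) / A + 1 = j / A := (Nat.div_eq_sub_div (by omega) hjA).symm
      -- the window carries the block bound `θ^{⌊j∕A⌋ − 1}·P`
      have hwin : ∀ i, i < j → j ≤ i + A → 1 / (gB (i + n)) ^ 2 - 1 / (gA i) ^ 2 ≤ θ ^ ((j - A) / A) * P := by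
        intro i hi hiA
        have h1 := ih i hi (by omega)
        have hexp : (j - A) / A ≤ i / A := Nat.div_le_div_right (by omega)
        exact h1.trans (mul_le_mul_of_nonneg_right (pow_le_pow_of_le_one hθ0 hθ1 hexp) hP0)
      have h := disc_le_firstMoment_mul hβ hb hρ0 hρA hA hB hApos hBpos hpin hjA (by omega) hGj hwin
      rw [← hq, pow_succ]
      calc 1 / (gB (j + n)) ^ 2 - 1 / (gA j) ^ 2 ≤ θ * (θ ^ ((j - A) / A) * P) := h
        _ = θ ^ ((j - A) / A) * θ * P := by ring

/-! ## §2 Pinned family with a bounded memory: the rate in the cutoff by the first moment -/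

/-- **THE BOUNDED-MEMORY RATE OF THE CONTINUUM COUPLING.**  A pinned family of runs of the order-0 profile family (`b > 0`, `γ > 0`, `ρ ≥ 0`,
`Σ_{a<N} ρ(a) ≤ W`; `g K` the run with `K` steps in ]0,γ], `g K K = g_IR`) whose profile is supported on the ages `≤ A` (`A ≥ 1`, ANY shape there),
with first moment `M₁ = Σ_{a≤A} a·ρ(a)`.  If `θ_m := M₁·γ∕(2(1∕g_IR² + b(m+1))) ≤ 1` THEN for every cutoff `n`:
`astar g m − invSq g m n ≤ θ_m^{⌊n∕A⌋}·((n+m)·W·γ)` — `disc_le_pow_blocks` for the pairs (`g (n+m)`, `g (n+m+N)`) up to the position `n` (every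
coupling below it sits at an infrared distance `≥ m + 1`, so its cube is `≤ γ∕(1∕g_IR² + b(m+1))` by g47's `prof_le_invSq_orderZero`; every matched
discrepancy is `≤ (n+m)Wγ` by g47's `continuum_monotone`), then `N → ∞`.  Geometric in `n∕A` with a ratio `O(1∕m)`: only the first moment of the
memory enters. [cite: Balaban1987RG1, (0.20) p.256, (0.31) and Thm 2 p.259] -/
theorem astar_sub_invSq_boundedMemory_rate
    (hβ : ∀ (k : ℕ) (p : Fin (k + 1) → ℝ),
      β k p = b + ∑ i : Fin (k + 1), ρ (k - i) * min (p (Fin.last k)) (|p (Fin.last k) - p i|))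
    (hb : 0 < b) (hγ : 0 < γ) (hρ0 : ∀ a, 0 ≤ ρ a) (hρW : ∀ n, ∑ a ∈ range n, ρ a ≤ W) {A : ℕ} (hA1 : 1 ≤ A)
    (hρA : ∀ a, A < a → ρ a = 0) {g : ℕ → ℕ → ℝ} {gIR : ℝ} (hrun : ∀ K, RGEqH K β (g K))
    (hbox : ∀ K i, i ≤ K → 0 < g K i ∧ g K i ≤ γ) (hpin : ∀ K, g K K = gIR) (m n : ℕ)
    (hθ1 : (∑ a ∈ range (A + 1), ρ a * a) * (γ / (2 * (1 / gIR ^ 2 + b * ((m + 1 : ℕ) : ℝ)))) ≤ 1) :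
    astar g m - invSq g m n
      ≤ ((∑ a ∈ range (A + 1), ρ a * a) * (γ / (2 * (1 / gIR ^ 2 + b * ((m + 1 : ℕ) : ℝ))))) ^ (n / A)
          * (((n + m : ℕ) : ℝ) * W * γ) := by
  have hcm := continuum_monotone hβ hb hγ hρ0 hρW hrun hbox hpin
  have hlim := hcm.1
  have hdist := hcm.2.1
  have hW : 0 ≤ W := by simpa using hρW 0
  have hgIR : 0 < gIR := by have := (hbox 0 0 le_rfl).1; rwa [hpin] at this
  have hD : 0 < 1 / gIR ^ 2 + b * ((m + 1 : ℕ) : ℝ) := by positivity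
  set G₃ : ℝ := γ / (1 / gIR ^ 2 + b * ((m + 1 : ℕ) : ℝ)) with hG₃
  have eθ : (∑ a ∈ range (A + 1), ρ a * a) * (γ / (2 * (1 / gIR ^ 2 + b * ((m + 1 : ℕ) : ℝ))))
      = (∑ a ∈ range (A + 1), ρ a * a) * (G₃ / 2) := by rw [hG₃]; field_simp
  rw [eθ] at hθ1 ⊢
  set P : ℝ := ((n + m : ℕ) : ℝ) * W * γ with hPdef
  have hP0 : 0 ≤ P := by rw [hPdef]; positivity
  -- the bound pair by pair
  have hpair : ∀ N, invSq g m (n + N) - invSq g m n ≤ ((∑ a ∈ range (A + 1), ρ a * a) * (G₃ / 2)) ^ (n / A) * P := by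
    intro N
    have hA' : RGEqH (n + m) β (g (n + m)) := hrun _
    have hB' : RGEqH (n + m + N) β (g (n + m + N)) := hrun _
    have hpin' : g (n + m) (n + m) = g (n + m + N) (n + m + N) := by rw [hpin, hpin]
    have hApos : ∀ k, k ≤ n + m → 0 < g (n + m) k := fun k hk => (hbox _ k hk).1
    have hBpos : ∀ k, k ≤ n + m + N → 0 < g (n + m + N) k := fun k hk => (hbox _ k hk).1
    -- every coupling below the position `n` has its cube `≤ G₃`
    have hG : ∀ i, i < n → (g (n + m) i) ^ 3 ≤ G₃ := by
      intro i hi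
      set x : ℝ := g (n + m) i with hx
      have hxpos : 0 < x := (hbox _ i (by omega)).1
      have hxγ : x ≤ γ := (hbox _ i (by omega)).2
      have hfloor := prof_le_invSq_orderZero hβ hρ0 hrun hbox hpin (n + m - i) i
      have hinv : invSq g (n + m - i) i = 1 / x ^ 2 := by rw [invSq_def, hx, show i + (n + m - i) = n + m by omega]
      rw [hinv] at hfloor
      have hDi : 1 / gIR ^ 2 + b * ((m + 1 : ℕ) : ℝ) ≤ 1 / gIR ^ 2 + b * ((n + m - i : ℕ) : ℝ) := by
        have : ((m + 1 : ℕ) : ℝ) ≤ ((n + m - i : ℕ) : ℝ) := by exact_mod_cast (show m + 1 ≤ n + m - i by omega)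
        nlinarith
      have hx2 : x ^ 2 ≤ 1 / (1 / gIR ^ 2 + b * ((m + 1 : ℕ) : ℝ)) := by
        rw [le_div_iff₀ hD]
        have := mul_le_mul_of_nonneg_left (hDi.trans hfloor) (pow_pos hxpos 2).le
        rwa [mul_one_div, div_self (pow_pos hxpos 2).ne'] at this
      calc x ^ 3 = x * x ^ 2 := by ring
        _ ≤ γ * (1 / (1 / gIR ^ 2 + b * ((m + 1 : ℕ) : ℝ))) := mul_le_mul hxγ hx2 (pow_pos hxpos 2).le hγ.le
        _ = G₃ := by rw [hG₃]; field_simp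
    -- every matched discrepancy is `≤ (n+m)Wγ`
    have hPall : ∀ i, i < A → i ≤ n + m → 1 / (g (n + m + N) (i + N)) ^ 2 - 1 / (g (n + m) i) ^ 2 ≤ P := by
      intro i _ hiK
      have e1 : 1 / (g (n + m + N) (i + N)) ^ 2 = invSq g (n + m - i) (i + N) := by
        rw [invSq_def, show i + N + (n + m - i) = n + m + N by omega]
      have e2 : 1 / (g (n + m) i) ^ 2 = invSq g (n + m - i) i := by
        rw [invSq_def, show i + (n + m - i) = n + m by omega]
      rw [e1, e2]
      have hmono := invSq_mono hβ hb hρ0 hrun hbox hpin (n + m - i)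
      have h1 : invSq g (n + m - i) (i + N) ≤ astar g (n + m - i) := hmono.ge_of_tendsto (hlim _) _
      have h2 := hdist (n + m - i) i
      rw [abs_le] at h2
      have h3 : ((n + m - i : ℕ) : ℝ) * W * γ ≤ P := by
        rw [hPdef]
        have : ((n + m - i : ℕ) : ℝ) ≤ ((n + m : ℕ) : ℝ) := by exact_mod_cast (Nat.sub_le _ _)
        have hWγ : 0 ≤ W * γ := mul_nonneg hW hγ.le
        nlinarith
      linarith [h2.1]
    have h := disc_le_pow_blocks hβ hb hρ0 hA1 hρA hA' hB' hApos hBpos hpin' (j₁ := n) (by omega) hG hθ1 hP0 hPall n le_rfl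
    have e1 : invSq g m (n + N) = 1 / (g (n + m + N) (n + N)) ^ 2 := by
      rw [invSq_def, show n + N + m = n + m + N by omega]
    have e2 : invSq g m n = 1 / (g (n + m) n) ^ 2 := by rw [invSq_def]
    rw [e1, e2]
    exact h
  have h1 : Tendsto (fun N => invSq g m (n + N) - invSq g m n) atTop (𝓝 (astar g m - invSq g m n)) :=
    ((hlim m).comp (tendsto_atTop_atTop_of_monotone (fun a b hab => by omega) fun N => ⟨N, by omega⟩)).sub
      tendsto_const_nhds
  exact le_of_tendsto' h1 hpair

/-- **BEYOND HALF THE MEMORY LENGTH THE CONTRACTION IS AUTOMATIC** (`Wγ ≤ b`): since `M₁ ≤ A·W`, `θ_m ≤ A·Wγ∕(2b(m+1)) ≤ A∕(2(m+1)) ≤ 1` as soon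
as `A ≤ 2(m+1)`; so for every infrared distance `m` with `2(m+1) ≥ A` and every cutoff `n`:
`astar g m − invSq g m n ≤ θ_m^{⌊n∕A⌋}·(n+m)·W·γ` with NO further hypothesis. [cite: Balaban1987RG1, (0.20) p.256, (0.31) and Thm 2 p.259] -/
theorem astar_sub_invSq_boundedMemory_rate_far
    (hβ : ∀ (k : ℕ) (p : Fin (k + 1) → ℝ),
      β k p = b + ∑ i : Fin (k + 1), ρ (k - i) * min (p (Fin.last k)) (|p (Fin.last k) - p i|))
    (hb : 0 < b) (hγ : 0 < γ) (hρ0 : ∀ a, 0 ≤ ρ a) (hρW : ∀ n, ∑ a ∈ range n, ρ a ≤ W) (hsmall : W * γ ≤ b) {A : ℕ}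
    (hA1 : 1 ≤ A) (hρA : ∀ a, A < a → ρ a = 0) {g : ℕ → ℕ → ℝ} {gIR : ℝ} (hrun : ∀ K, RGEqH K β (g K))
    (hbox : ∀ K i, i ≤ K → 0 < g K i ∧ g K i ≤ γ) (hpin : ∀ K, g K K = gIR) {m : ℕ} (hmA : A ≤ 2 * (m + 1)) (n : ℕ) :
    astar g m - invSq g m n
      ≤ ((∑ a ∈ range (A + 1), ρ a * a) * (γ / (2 * (1 / gIR ^ 2 + b * ((m + 1 : ℕ) : ℝ))))) ^ (n / A)
          * (((n + m : ℕ) : ℝ) * W * γ) := by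
  refine astar_sub_invSq_boundedMemory_rate hβ hb hγ hρ0 hρW hA1 hρA hrun hbox hpin m n ?_
  have hgIR : 0 < gIR := by have := (hbox 0 0 le_rfl).1; rwa [hpin] at this
  have hW : 0 ≤ W := by simpa using hρW 0
  -- `M₁ ≤ A·W`
  have hM : ∑ a ∈ range (A + 1), ρ a * a ≤ (A : ℝ) * W := by
    calc ∑ a ∈ range (A + 1), ρ a * a ≤ ∑ a ∈ range (A + 1), ρ a * A :=
          Finset.sum_le_sum fun a ha => mul_le_mul_of_nonneg_left
            (by exact_mod_cast Nat.lt_succ_iff.mp (Finset.mem_range.mp ha)) (hρ0 a)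
      _ = (∑ a ∈ range (A + 1), ρ a) * A := by rw [Finset.sum_mul]
      _ ≤ W * A := mul_le_mul_of_nonneg_right (hρW (A + 1)) (Nat.cast_nonneg A)
      _ = (A : ℝ) * W := by ring
  have hD : 0 < 1 / gIR ^ 2 + b * ((m + 1 : ℕ) : ℝ) := by positivity
  have hDb : b * ((m + 1 : ℕ) : ℝ) ≤ 1 / gIR ^ 2 + b * ((m + 1 : ℕ) : ℝ) := by
    have : 0 ≤ 1 / gIR ^ 2 := by positivity
    linarith
  have hmA' : (A : ℝ) ≤ 2 * ((m + 1 : ℕ) : ℝ) := by exact_mod_cast hmA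
  rw [mul_div_assoc', div_le_one (by positivity)]
  calc (∑ a ∈ range (A + 1), ρ a * a) * γ ≤ (A : ℝ) * W * γ := by nlinarith
    _ = (A : ℝ) * (W * γ) := by ring
    _ ≤ 2 * ((m + 1 : ℕ) : ℝ) * b := mul_le_mul hmA' hsmall (mul_nonneg hW hγ.le) (by positivity)
    _ = 2 * (b * ((m + 1 : ℕ) : ℝ)) := by ring
    _ ≤ 2 * (1 / gIR ^ 2 + b * ((m + 1 : ℕ) : ℝ)) := by linarith

end Summit.QuantumFields.BalabanUV.Beta.RemainderExplicitHistoryDiagonalBoundedMemoryRate
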